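import Literature.Barriers.ResolutionOfSingularities.StratumFirstInvIncrease
import Literature.AlgebraicGeometry.Hironaka2017.Proofs.S04CharAlgebra.WQExcEdge
import HarnessLib

/-!
# Barrier supplement: `StratumFirstInvIncrease` — the «same `Inv`» step on the exceptional section `E_y`, IN THE KERNEL
# (edge ideal `(x̄²)`, `r = 1`, `q₁ = 2`, Eq. (34) value `(5,4,2)` at every point of `E_y`, algebraic `℘`)

`Literature/Barriers/ResolutionOfSingularities/StratumFirstInvIncreaseEdge.lean` — kernel SUPPLEMENT to the catalogue entry
`StratumFirstInvIncrease.lean` (p491195; cell res-hironaka, D-0089; director-resolution 2026-08-27T03:20:33Z: «the [claim]-level Inv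
sentences inside #2/#3 stay labelled hand+kit until an Inv-in-kernel typer lands them»; drafter res-type-046, the entry's filer).
The parent entry PROVES that every point of the exceptional `ℙ³ ∩ {x̄ = 0}` of the first point blow-up of a tangentially trivial double
point `x² + G`, `ord G ≥ 5`, is again a double point with initial form `x̄²`, and RECORDS as hand + kit (K3.5 report §6) the step to
«the manuscript's bare `Inv` of Eq. (34) stays `(5,4,2)` there». This file proves that step for the chart `E_y ≅ 𝔸³` of the W-Q
specimen, at the level of the cell's typed ALGEBRAIC characteristic algebra (`Hironaka2017/S04CharAlgebra.pAlgebraicRing`, the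
manuscript's p.17 l.8–11 definition): see `StratumFirstInvIncreaseEdge` below and the three kernel files
`Hironaka2017/Proofs/S04CharAlgebra/WQExc{Arc,Taylor,Edge}.lean` (square-root arc through the generic direction; four point classes)
over the engine `Hironaka2017/Lib/PAlgArc{Weight,Order}.lean` (arc weight bound for the integral closure; grading arc; order bound).

HONEST FRAMING. H. Hironaka, *Resolution of singularities in positive characteristics*, ms. 2017 [Hironaka2017] is an UNREFEREED
MANUSCRIPT UNDER ADJUDICATION (D-0012); its definitions (`℘`, edge data Def. 4.9, `Inv` Eq. (34)) are typed by the cell as candidates and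
only COMPUTED WITH here, on the cell's OWN specimen; nothing printed in the manuscript is asserted, nothing here is a verdict on any
printed sentence, nothing bears on resolution of singularities in characteristic `p`. AI proof, weaker than expert review.

## Contents
* `StratumFirstEdge.chart_y_fW` — the parent entry's `y`-chart of the blow-up applied to `fW` is `y² · f_{(0,0,0)}` (link to `WQExc.fξ`);
* `StratumFirstEdge.translate`, `translate_f` — `f_ξ = f_{(0,0,0)}(x, y, z + z₀, w + w₀, v + v₀)`: the family `WQExc.fξ` IS the
  transform re-centred at the point `ξ = (0,0,z₀,w₀,v₀)` of `E_y`;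
* `StratumFirstInvIncreaseEdge` — the headline conjunction (order bound; `x̄² ∣` every initial form; no order-`1` element; lift identity).
-/

noncomputable section

namespace Literature.Barriers.ResolutionOfSingularities

open MvPolynomial Literature.AlgebraicGeometry.Hironaka2017.S04CharAlgebra

universe u

namespace StratumFirstEdge

variable (K : Type u) [Field K]

/-- **Link to the barrier's chart**: the `y`-chart (`StratumFirst.chart K 0`) of the blow-up of the origin applied to the W-Q
witness `fW` is `y² · f_ξ` with `ξ` the origin of `E_y` (`WQExc.fξ K 0 0 0 = x² + y⁵H₁`, the cell certificate p487890's `fW1`).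
[claim: Hironaka2017, status: under-review]
[cite: Hironaka2017, Def. 4.9 p.20 l.31–35 · Eq. (34) p.24 l.29–31 (unrefereed manuscript under adjudication — kernel fact about the cell's own specimen, nothing of the manuscript asserted)] -/
theorem chart_y_fW : StratumFirst.chart K (0 : Fin 4) Literature.AlgebraicGeometry.Hironaka2017.WQWitness.fW =
    X 1 ^ 2 * WQExc.fξ K 0 0 0 := by
  simp only [StratumFirst.chart, Literature.AlgebraicGeometry.Hironaka2017.WQWitness.fW, WQExc.fξ, WQExc.Hξ, map_add,
    map_mul, map_pow, aeval_X, rename_X, map_zero, add_zero]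
  simp only [Fin.succ_zero_eq_one, Fin.isValue, Fin.reduceEq, if_true, if_false]
  rw [show (Fin.succ 1 : Fin 5) = 2 from rfl, show (Fin.succ 2 : Fin 5) = 3 from rfl, show (Fin.succ 3 : Fin 5) = 4 from rfl]
  ring

/-- The translation `(x, y, z, w, v) ↦ (x, y, z + z₀, w + w₀, v + v₀)` moving the point `ξ = (0,0,z₀,w₀,v₀)` of `E_y` to the origin
(a `K`-algebra endomorphism of `K[x,y,z,w,v]`; it is the automorphism with inverse the opposite translation). [folklore] -/
def translate (z₀ w₀ v₀ : K) : MvPolynomial (Fin 5) K →ₐ[K] MvPolynomial (Fin 5) K :=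
  aeval ![X 0, X 1, X 2 + C z₀, X 3 + C w₀, X 4 + C v₀]

/-- **The family `f_ξ` IS the transform re-centred**: translating `f′ = f_{(0,0,0)}` by `ξ` gives `f_ξ`.
[claim: Hironaka2017, status: under-review]
[cite: Hironaka2017, Def. 4.9 p.20 l.31–35 · Eq. (34) p.24 l.29–31 (unrefereed manuscript under adjudication — kernel fact about the cell's own specimen, nothing of the manuscript asserted)] -/
theorem translate_f (z₀ w₀ v₀ : K) : translate K z₀ w₀ v₀ (WQExc.fξ K 0 0 0) = WQExc.fξ K z₀ w₀ v₀ := by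
  simp only [translate, WQExc.fξ, WQExc.Hξ, map_add, map_mul, map_pow, aeval_X, rename_X, rename_C, map_zero, add_zero]
  rw [show (Fin.succ 0 : Fin 5) = 1 from rfl, show (Fin.succ 1 : Fin 5) = 2 from rfl, show (Fin.succ 2 : Fin 5) = 3 from rfl,
    show (Fin.succ 3 : Fin 5) = 4 from rfl]
  simp only [Fin.isValue, Matrix.cons_val_zero, Matrix.cons_val_one, Matrix.cons_val]

end StratumFirstEdge

open StratumFirstEdge in
/-- **`StratumFirstInvIncreaseEdge` — KERNEL SUPPLEMENT to the barrier entry `StratumFirstInvIncrease` (p491195): the «same `Inv`»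
step on the exceptional section `E_y`, at the level of the ALGEBRAIC characteristic algebra.**

The entry's docstring marks as HAND + kit (K3.5 report §6) the step from «every point of the exceptional `ℙ³ = exc₁ ∩ ℙ(x̄ = 0)` is a
double point with initial form `x̄²`» (kernel there) to «the manuscript's bare `Inv` of Eq. (34) p.24 stays `(5,4,2)` on the whole
`ℙ³`» («no order-`1` element of `℘(Ê′,1)` at those points»). THIS THEOREM is that step in the kernel for the chart `E_y ≅ 𝔸³` of `ℙ³`
(all its `K`-points, `K` any field of characteristic `2`), for OUR typed ALGEBRAIC `℘` (`S04CharAlgebra.pAlgebraicRing`, the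
manuscript's algebraic definition p.17 l.8–11 typed by row 003; its agreement with the geometric `℘` is the manuscript's import from
[23], Th. 4.4 / U17_4, and is NOT used or asserted here): with `E′_ξ = ((f_ξ), 2)`, `f_ξ = x² + y⁵H_ξ` the `y`-chart transform of
`(fW, 2)` centred at `ξ = (0,0,z₀,w₀,v₀) ∈ E_y` (`chart_y_fW`, `translate_f`) and `℘alg(E′_ξ, a)` its degree-`a` piece
(`WQExc.P`):
* (i) `℘alg(E′_ξ, a) ⊆ 𝔪_ξ^a` for every `a` (so initial forms `ν(g T^a) ∈ 𝔪_ξ^a/𝔪_ξ^{a+1} = K[x̄,ȳ,z̄,w̄,v̄]_a` are defined, Rem. 4.7 p.20);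
* (ii) for `a ≥ 1` the degree-`a` initial form of EVERY `g ∈ ℘alg(E′_ξ, a)` is divisible by `x̄²` («hup»);
* (ii′) in particular `℘alg(E′_ξ, 1) ⊆ 𝔪_ξ²`: NO element of order `1` — no `y◦` in Def. 4.11 p.21 (`t = 0`), at ANY point of `E_y`;
* (iii) `f_ξ ∈ ℘alg(E′_ξ, 2)` and `f_ξ − x² ∈ 𝔪_ξ⁵`: the form `x̄²` is attained (lift of Eq. (24)/(25) shape, `q = 2 = 2¹`).
Hence (Def. 4.9 p.20 l.31–35: minimum system of homogeneous generators of the edge ideal `ν(℘(E)_ξ)`; the cell's kernel pattern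
`hup + lift identity ⇒ exists_isEdgeData_pure`, `Hironaka2017/Proofs/S16Proof/InvSlotSingAlign`): the edge ideal of `℘alg(E′)` at
every `K`-point of `E_y` is `(x̄²)` — one generator, `r = 1`, `q₁ = 2` — i.e. the Eq. (34) value `(n, n − r, q₁) = (5, 4, 2)`,
CONSTANT along the `3`-dimensional exceptional section although the centre was a point. Method: `Hironaka2017/Lib/PAlgArcWeight`
(arc weight bound for the integral closure), `Lib/PAlgArcOrder` (grading arc, order bound), `Proofs/S04CharAlgebra/WQExc{Arc,Taylor,Edge}`
(the square-root arc through the generic direction, four point classes). NOT covered here (still hand + kit as recorded in the entry):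
the `ℙ² = ℙ³ ∖ E_y` seen only in the `z, w, v`-charts; the later steps of K3.5's `γ`-tower; the identification for the GEOMETRIC `℘`;
anything about `Σ_max` of the companion entry `SigmaMaxContainsFullEdimCurve`. Nothing here is a claim about resolution of singularities
in characteristic `p`, nor a verdict on any printed sentence (D-0012/D-0089). [claim: Hironaka2017, status: under-review]
[cite: Hironaka2017, Rem. 4.7 / Def. 4.9 p.20 l.13–35 · Def. 4.11 p.21 · Eq. (34) p.24 l.29–31 · §4 p.17 l.8–11 (unrefereed manuscript under adjudication — kernel computation of OUR typed algebraic ℘ at the cell's specimen, nothing of the manuscript asserted)]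

BARRIER (D-0021) — ADDENDUM to `StratumFirstInvIncrease` (same entry; this file upgrades one of its scope caveats):
- technique_class: stratum-first top-locus-first bare-invariant no-boundary-datum intrinsic-stratification initial-form-type edge-data characteristic-algebra exceptional-divisor positive-characteristic
- blocks: as the parent entry; sharpened: on the W-Q specimen the manuscript-style edge datum itself (Def. 4.9 / Eq. (34), computed for the typed ALGEBRAIC `℘`) is CONSTANT `= (5,4,2)` along the whole exceptional section `E_y ≅ 𝔸³` after the first point blow-up — a «blow up the `Inv`-top stratum» recipe keyed to the bare `Inv` sees a `3`-dimensional top stratum born from a point centre [claim: Hironaka2017, status: under-review] (the definitions are the manuscript's, typed by the cell; the computation is OURS and kernel-checked here for `E_y`).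
- because: the square-root arc `Φ_ξ : x ↦ t¹⁰s, (y,z,w,v) ↦ δt⁴` through the GENERIC direction lies on `f_ξ = 0` in characteristic `2` (`s² = δ₀⁵H_ξ(δt⁴)` by Frobenius) while `∂f_ξ ∈ (y⁴)` has weight `≥ 16` (`≥ 20` where `H_ξ(0) = 0`); integrality of `℘alg` over the Diff-algebra transports to `t^{16a} ∣ Φ_ξ(g)` (`Lib/PAlgArcWeight`), and the two lowest informative coefficients of `Φ_ξ(g)` are the `x̄`-free and the `x̄`-linear parts of the initial form of `g` evaluated at the generic point (times `σ_j = √u_j`, with `σ₁ ∉ Frac K[y,z,w,v]` separating the one collision) (`WQExc.coeff_Φ_4a`, `coeff_Φ_N`, `hom_G_zero_eq_zero`, `hom_G_one_eq_zero`).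
- evasions_known: as the parent entry ((i) boundary-aware second letter; (ii) `a = 1` centres; (iii) weighted/characteristic-polyhedron centres); nothing new.
- scope_caveats: (a) PROVED here: parent scope (b)'s hand step «same initial-form type ⇒ same `Inv`» for the chart `E_y` of the exceptional `ℙ³`, all `K`-points, every field `K` of characteristic `2`, for the ALGEBRAIC `℘` of the manuscript's p.17 definition as typed by row 003 (`pAlgebraicRing` over the polynomial ring of the chart); (b) NOT covered: the `ℙ² = ℙ³ ∖ E_y` (the `z, w, v`-charts), the later steps of K3.5's `γ`-tower, the passage algebraic `℘` ↔ geometric `℘` (the manuscript's import from [23], U17_4) and to stalks (locality), and everything about `Σ_max` of `SigmaMaxContainsFullEdimCurve` — these stay hand + kit as recorded in the parent entries; (c) nothing here bears on the EXISTENCE of resolutions in characteristic `p`.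
- status: established (kernel-checked: `E_y`, all `K`-points, characteristic `2`, algebraic `℘`) -/
theorem StratumFirstInvIncreaseEdge :
    ∀ (K : Type u) [Field K] [CharP K 2] (z₀ w₀ v₀ : K),
      (∀ a : ℕ, WQExc.P K z₀ w₀ v₀ a ≤ MvPolynomial.idealOfVars (Fin 5) K ^ a) ∧
      (∀ a : ℕ, 1 ≤ a → ∀ g ∈ WQExc.P K z₀ w₀ v₀ a,
          (X 0 : MvPolynomial (Fin 5) K) ^ 2 ∣ MvPolynomial.homogeneousComponent a g) ∧
      WQExc.P K z₀ w₀ v₀ 1 ≤ MvPolynomial.idealOfVars (Fin 5) K ^ 2 ∧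
      WQExc.fξ K z₀ w₀ v₀ ∈ WQExc.P K z₀ w₀ v₀ 2 ∧
      WQExc.fξ K z₀ w₀ v₀ - X 0 ^ 2 ∈ MvPolynomial.idealOfVars (Fin 5) K ^ 5 := by
  intro K _ _ z₀ w₀ v₀
  exact ⟨WQExc.P_le_pow K z₀ w₀ v₀, fun _ ha _ hg => WQExc.X_sq_dvd_initialForm K ha hg, WQExc.P_one_le_sq K z₀ w₀ v₀,
    WQExc.f_mem_P_two K z₀ w₀ v₀, WQExc.f_sub_sq_mem K z₀ w₀ v₀⟩

end Literature.Barriers.ResolutionOfSingularities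

end
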